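import Literature.AlgebraicGeometry.Morphisms.CechH1
import HarnessLib

/-!
# Pullback of Čech cochains and of `Ȟ¹(𝒰, 𝒪_X)` along a morphism of `A`-schemes

`Morphisms/CechH1` defines, for a scheme `f : X → Spec A` over a ring `A` and a family of opens
`U : ι → X.Opens`, the Čech complex of the structure sheaf in degrees `≤ 2` as `A`-modules
(`CechC0/1/2`, `cechD0`, `cechD1`) and `Ȟ¹(𝒰, 𝒪_X)` (`CechH1 f U`). For a morphism
`g : Y → X` of `A`-schemes (`g ≫ f_X = f_Y`) this file provides the pullback along `g` to the
preimage family `g⁻¹𝒰 = (g⁻¹U_i)_i` (The Stacks Project, Tag 01ED = Cohomology, Section 20.9: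
functoriality of the Čech complex in the pair (space, covering); Tag 09UY for refinements):

* `Sections.comap g e : Sections f_X V →ₐ[A] Sections f_Y W` for `W ⊆ g⁻¹V` (Mathlib
  `Scheme.Hom.appLE`), an `A`-algebra homomorphism, compatible with restrictions;
* `cechComapC0/C1/C2` — the cochain maps `Čᵖ(𝒰, 𝒪_X) → Čᵖ(g⁻¹𝒰, 𝒪_Y)`, commuting with `d⁰`, `d¹`
  (`cechD0_comapC0`, `cechD1_comapC1`), hence mapping cocycles to cocycles and coboundaries to
  coboundaries;
* `cechComapH1 : Ȟ¹(𝒰, 𝒪_X) →ₗ[A] Ȟ¹(g⁻¹𝒰, 𝒪_Y)`, with `cechComapH1_mk`.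

This is the map `H¹(X_s, 𝒪_{X_s}) → H¹(X_{i,s}, 𝒪_{X_{i,s}})` (24.14.1) of Görtz–Wedhorn II,
Lemma 24.72 in Čech form, needed to state the Künneth injectivity used in the proof of the
theorem of the cube (Thm. 24.73). Mathlib searched (pin): `Scheme.Hom.appLE`, `appLE_map`,
`map_appLE`, `Scheme.comp_appTop`, `Scheme.ΓSpecIso` (used); Mathlib has no Čech cohomology of
schemes. Related: `Literature.AlgebraicGeometry.Morphisms.CechH1` and `LiftData` (connecting map
for `𝒪` along principal thickenings) in `Morphisms/CechH1`.

## References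

* The Stacks Project, Tag 01ED (Cohomology, Section 20.9, Čech cohomology and its functoriality)
  and Tag 09UY (refinements). [StacksProject]
* U. Görtz, T. Wedhorn, *Algebraic Geometry II: Cohomology of Schemes* (2023),
  doi:10.1007/978-3-658-43031-3: (24.14.1), Lemma 24.72, p. 548; Thm. 22.9, p. 332 (Čech versus
  derived cohomology for affine coverings of separated schemes). [GortzWedhorn2023]
-/

noncomputable section

open CategoryTheory AlgebraicGeometry Limits TopologicalSpace Opposite

universe u v

namespace Literature.AlgebraicGeometry.Morphisms

section Preimage

variable {X Y : Scheme.{u}} {ι : Type v}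

/-- The preimage family `g⁻¹𝒰 = (g⁻¹U_i)_i` of a family of opens. [folklore] -/
abbrev preimageFamily (g : Y ⟶ X) (U : ι → X.Opens) : ι → Y.Opens := fun i => g ⁻¹ᵁ U i

end Preimage

variable {A : Type u} [CommRing A] {X Y : Scheme.{u}} (fX : X ⟶ Spec (.of A))
  (fY : Y ⟶ Spec (.of A)) (g : Y ⟶ X) (hg : g ≫ fX = fY)

include hg

/-! ## Pullback of sections -/

namespace Sections

/-- The structure maps are compatible: `g^*(a · 1_X) = a · 1_Y` on global sections. [folklore] -/
theorem appTop_algebraMapΓ (a : A) : g.appTop (algebraMapΓ fX a) = algebraMapΓ fY a := by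
  rw [algebraMapΓ, algebraMapΓ, ← hg, Scheme.Hom.comp_appTop]
  rfl

/-- **Pullback of sections along a morphism of `A`-schemes**: for `W ⊆ g⁻¹V`,
`Γ(X, V) → Γ(Y, W)` (Mathlib `Scheme.Hom.appLE`) as an `A`-algebra homomorphism
`Sections f_X V → Sections f_Y W`. [folklore] -/
def comap {V : X.Opens} {W : Y.Opens} (e : W ≤ g ⁻¹ᵁ V) : Sections fX V →ₐ[A] Sections fY W :=
  { (g.appLE V W e).hom with
    commutes' := fun a => by
      change g.appLE V W e (X.presheaf.map (homOfLE le_top).op (algebraMapΓ fX a)) =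
        Y.presheaf.map (homOfLE le_top).op (algebraMapΓ fY a)
      have e1 : g.appLE ⊤ ⊤ le_top = g.appTop := by
        rw [Scheme.Hom.appTop, Scheme.Hom.app_eq_appLE]; rfl
      rw [← appTop_algebraMapΓ fX fY g hg, ← CommRingCat.comp_apply, Scheme.Hom.map_appLE,
        ← e1, ← CommRingCat.comp_apply, Scheme.Hom.appLE_map] }

/-- `comap` is `appLE`. [folklore] -/
theorem comap_apply {V : X.Opens} {W : Y.Opens} (e : W ≤ g ⁻¹ᵁ V) (s : Sections fX V) :
    comap fX fY g hg e s = g.appLE V W e s :=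
  rfl

/-- Pullback commutes with restriction (target side). [folklore] -/
theorem res_comap {V : X.Opens} {W W' : Y.Opens} (e : W ≤ g ⁻¹ᵁ V) (h : W' ≤ W)
    (s : Sections fX V) :
    res fY h (comap fX fY g hg e s) = comap fX fY g hg (h.trans e) s := by
  rw [res_apply, comap_apply, comap_apply, ← CommRingCat.comp_apply, Scheme.Hom.appLE_map]

/-- Pullback commutes with restriction (source side). [folklore] -/
theorem comap_res {V V' : X.Opens} {W : Y.Opens} (h : V' ≤ V) (e : W ≤ g ⁻¹ᵁ V')
    (s : Sections fX V) :
    comap fX fY g hg e (res fX h s) = comap fX fY g hg (e.trans fun _ hx => h hx) s := by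
  rw [res_apply, comap_apply, comap_apply, ← CommRingCat.comp_apply, Scheme.Hom.map_appLE]

end Sections

/-! ## Pullback of Čech cochains and of `Ȟ¹` -/

section Cech

variable {ι : Type v} (U : ι → X.Opens)

/-- Pullback of `0`-cochains, `(g^*b)_i = g^*(b_i)`.
[cite: StacksProject, Tag 01ED (Cohomology, Section 20.9)] -/
def cechComapC0 : CechC0 fX U →ₗ[A] CechC0 fY (preimageFamily g U) where
  toFun b i := Sections.comap fX fY g hg le_rfl (b i)
  map_add' b b' := by ext i; exact map_add _ (b i) (b' i)
  map_smul' a b := by ext i; exact map_smul _ a (b i)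

/-- Pullback of `1`-cochains, `(g^*c)_{ij} = g^*(c_{ij})` on `g⁻¹U_i ∩ g⁻¹U_j`.
[cite: StacksProject, Tag 01ED (Cohomology, Section 20.9)] -/
def cechComapC1 : CechC1 fX U →ₗ[A] CechC1 fY (preimageFamily g U) where
  toFun c i j := Sections.comap fX fY g hg (fun _ hx => hx) (c i j)
  map_add' c c' := by ext i j; exact map_add _ (c i j) (c' i j)
  map_smul' a c := by ext i j; exact map_smul _ a (c i j)

/-- Pullback of `2`-cochains. [cite: StacksProject, Tag 01ED (Cohomology, Section 20.9)] -/
def cechComapC2 : CechC2 fX U →ₗ[A] CechC2 fY (preimageFamily g U) where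
  toFun c i j k := Sections.comap fX fY g hg (fun _ hx => hx) (c i j k)
  map_add' c c' := by ext i j k; exact map_add _ (c i j k) (c' i j k)
  map_smul' a c := by ext i j k; exact map_smul _ a (c i j k)

/-- Unfolding of `cechComapC0`. [folklore] -/
theorem cechComapC0_apply (b : CechC0 fX U) (i : ι) :
    cechComapC0 fX fY g hg U b i = Sections.comap fX fY g hg le_rfl (b i) := rfl

/-- Unfolding of `cechComapC1`. [folklore] -/
theorem cechComapC1_apply (c : CechC1 fX U) (i j : ι) :
    cechComapC1 fX fY g hg U c i j = Sections.comap fX fY g hg (fun _ hx => hx) (c i j) := rfl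

/-- Unfolding of `cechComapC2`. [folklore] -/
theorem cechComapC2_apply (c : CechC2 fX U) (i j k : ι) :
    cechComapC2 fX fY g hg U c i j k = Sections.comap fX fY g hg (fun _ hx => hx) (c i j k) :=
  rfl

/-- **`g^*` commutes with `d⁰`.** [cite: StacksProject, Tag 01ED (Cohomology, Section 20.9)] -/
theorem cechD0_comapC0 (b : CechC0 fX U) :
    cechD0 fY (preimageFamily g U) (cechComapC0 fX fY g hg U b) =
      cechComapC1 fX fY g hg U (cechD0 fX U b) := by
  ext i j
  simp only [cechD0_apply, cechComapC0_apply, cechComapC1_apply, map_sub, Sections.res_comap,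
    Sections.comap_res]
  rfl

/-- **`g^*` commutes with `d¹`.** [cite: StacksProject, Tag 01ED (Cohomology, Section 20.9)] -/
theorem cechD1_comapC1 (c : CechC1 fX U) :
    cechD1 fY (preimageFamily g U) (cechComapC1 fX fY g hg U c) =
      cechComapC2 fX fY g hg U (cechD1 fX U c) := by
  ext i j k
  simp only [cechD1_apply, cechComapC1_apply, cechComapC2_apply, map_sub, map_add,
    Sections.comap_res]
  erw [Sections.res_comap, Sections.res_comap, Sections.res_comap]
  rfl

/-- `g^*` maps cocycles to cocycles. [folklore] -/
theorem comapC1_mem_cechZ1 {c : CechC1 fX U} (hc : c ∈ cechZ1 fX U) :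
    cechComapC1 fX fY g hg U c ∈ cechZ1 fY (preimageFamily g U) := by
  rw [mem_cechZ1_iff] at hc ⊢
  rw [cechD1_comapC1, hc, map_zero]

/-- `g^*` maps coboundaries to coboundaries. [folklore] -/
theorem comapC1_mem_cechB1 {c : CechC1 fX U} (hc : c ∈ cechB1 fX U) :
    cechComapC1 fX fY g hg U c ∈ cechB1 fY (preimageFamily g U) := by
  rw [mem_cechB1_iff] at hc ⊢
  obtain ⟨b, rfl⟩ := hc
  exact ⟨cechComapC0 fX fY g hg U b, cechD0_comapC0 fX fY g hg U b⟩

/-- `g^*` on cocycles. [folklore] -/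
def cechComapZ1 : ↥(cechZ1 fX U) →ₗ[A] ↥(cechZ1 fY (preimageFamily g U)) :=
  (cechComapC1 fX fY g hg U).restrict fun _ hc => comapC1_mem_cechZ1 fX fY g hg U hc

/-- Unfolding of `cechComapZ1`. [folklore] -/
@[simp]
theorem cechComapZ1_coe (z : cechZ1 fX U) :
    (cechComapZ1 fX fY g hg U z : CechC1 fY (preimageFamily g U)) =
      cechComapC1 fX fY g hg U z :=
  rfl

/-- **Pullback on `Ȟ¹`**: `g^* : Ȟ¹(𝒰, 𝒪_X) → Ȟ¹(g⁻¹𝒰, 𝒪_Y)` — Čech form of the restriction map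
`H¹(X, 𝒪_X) → H¹(Y, 𝒪_Y)`, e.g. (24.14.1) of Görtz–Wedhorn II, Lemma 24.72.
[cite: StacksProject, Tag 01ED (Cohomology, Section 20.9)] -/
def cechComapH1 : CechH1 fX U →ₗ[A] CechH1 fY (preimageFamily g U) :=
  Submodule.mapQ _ _ (cechComapZ1 fX fY g hg U) fun z hz => by
    rw [Submodule.mem_comap] at hz ⊢
    exact comapC1_mem_cechB1 fX fY g hg U hz

/-- `g^*[z] = [g^*z]`. [folklore] -/
@[simp]
theorem cechComapH1_mk (z : cechZ1 fX U) :
    cechComapH1 fX fY g hg U (CechH1.mk fX U z) =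
      CechH1.mk fY (preimageFamily g U) (cechComapZ1 fX fY g hg U z) :=
  rfl

/-- `g^*[z] = 0` iff `g^*z` is a coboundary. [folklore] -/
theorem cechComapH1_mk_eq_zero_iff (z : cechZ1 fX U) :
    cechComapH1 fX fY g hg U (CechH1.mk fX U z) = 0 ↔
      cechComapC1 fX fY g hg U z ∈ cechB1 fY (preimageFamily g U) := by
  rw [cechComapH1_mk, CechH1.mk_eq_zero_iff, cechComapZ1_coe]

end Cech

end Literature.AlgebraicGeometry.Morphisms

end
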